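import Literature.AnabelianGeometry.AbsoluteAnabelian.AbsTopILem27iii
import Literature.AnabelianGeometry.AbsoluteAnabelian.AbsTopIThm26PrimesOfRankExcessHook
import HarnessLib

/-!
# [AbsTopI] Thm 2.6 (iii) second clause and Thm 2.6 (v) (`Σ = Primes`) from Lemma 2.7 (iii) — bridges

S. Mochizuki, *Topics in Absolute Anabelian Geometry I: Generalities* (2012) [AbsTopI], Thm 2.6 (iii)
p. 22, proof p. 23 l. 41–47; Thm 2.6 (v) p. 22, proof p. 24.

PROOF-ONLY companion of the statement file `AbsTopILem27iii.lean` (named fact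
`FundamentalExtension.Lem27iiiStep`, successor row `FundamentalExtension.Thm26iii'`; row
«LEM27iii-TYPE», abc-iut cell seat abc-iut-w6-d073).  The group theory AROUND the Tate-module input
is abc-iut-w6-d034's (`AbsTopIThm26iiiRankExcessPrep.lean`: `|θ¹(H)| ≥ 2 ⟹` an open `J ⊆ H` and
`l₀ ∈ Σ`, `l₀ ≠ p`, with `δ¹_{l₀}(G_J) = 1 < 2 ≤ δ¹_{l₀}(J)`; `AbsTopIThm26PrimesOfRankExcessHook.lean`:
the node closers from a "hook" `∀ J open, (rank excess at some l₀ ∈ Σ) → {l ∈ Σ prime} ⊆ θ²(J)`).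
This file supplies the hook from the fact and instantiates the closers:

* `subset_thetaSet_two_of_rankExcess` — THE HOOK from `Lem27iiiStep`: each prime `l ∈ Σ` gets an open
  `H′ ⊆ J` with `δ²_l(H′) ≥ 1`, so `ε²_l(J) ≥ 1` (`mem_thetaSet_two_of_le_of_one_le_deltaInv`);
* `subset_thetaSet_two_of_lem27iiiStep` — `|θ¹(H₀)| ≥ 2 ⟹ {l ∈ Σ prime} ⊆ θ²(H₀)` for every open
  `H₀ ⊆ Π` (MLF base, `Δ` pro-`Σ`, `Lem27iiiStep`);
* `thm26iii_of_lem27iiiStep` — the typed `E.Thm26iii S` PROVED MODULO exactly `Lem27iiiStep`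
  (with `Π` tfg for the first clause); `thm26iii'_holds` — the successor row for every extension and
  every `Σ`; `thm26iii_open_of_lem27iiiStep` — both clauses for every open `H ⊆ Π` (the input `hiii`
  of `MLFBase.thm26vFull_of_rank_of_thm26iii_open`);
* `MLFBase.thm26vFull_of_rank_of_lem27iiiStep`, `MLFBase.thm26vFull_of_lem27iiiStep`,
  `MLFBase.thm26vFull_of_starCondition_of_lem27iiiStep` — abc-iut-w6-d034's Thm 2.6 (v) closers with
  their (iii)-input discharged by the fact.

HONEST FRAMING: refereed, undisputed statements; `Lem27iiiStep` is a hypothesis on data (geometric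
origin); nothing here bears on [IUTchIII] Cor. 3.12; typed ≠ proved.
-/

noncomputable section

open Topology

namespace Literature.AnabelianGeometry.AbsoluteAnabelian

universe u


/-! ### Traces of open subgroups (bookkeeping) -/

section Subgroups

variable {G : Type u} [Group G] [TopologicalSpace G]

/-- For subgroups `H′ ≤ H₀` of `G`, the trace `H′ ∩ H₀` (a subgroup of `H₀`) is isomorphic to `H′` as a
topological group. [folklore] -/
private theorem nonempty_continuousMulEquiv_subgroupOf {H' H₀ : Subgroup G} (h : H' ≤ H₀) :
    Nonempty (↥(H'.subgroupOf H₀) ≃ₜ* ↥H') :=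
  ⟨{ Subgroup.subgroupOfEquivOfLe h with
      continuous_toFun := (continuous_subtype_val.comp continuous_subtype_val).subtype_mk _
      continuous_invFun := (continuous_subtype_val.subtype_mk _).subtype_mk _ }⟩

/-- The trace on `H₀` of an open subgroup `H′ ⊆ G` is open in `H₀`. [folklore] -/
private theorem isOpen_subgroupOf {H' : Subgroup G} (H₀ : Subgroup G) (hH' : IsOpen (H' : Set G)) :
    IsOpen ((H'.subgroupOf H₀ : Subgroup ↥H₀) : Set ↥H₀) := by
  rw [Subgroup.coe_subgroupOf]
  exact hH'.preimage continuous_subtype_val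

/-- `l ∈ θ²(H₀)` as soon as some open `H′ ⊆ G` inside `H₀` has `δ²_l(H′) ≥ 1` (`ε²_l(H₀)` is the
supremum of the `δ²_l` of the open subgroups of `H₀`, among them the trace of `H′`).
[cite: MochizukiAbsTopI2012, Thm 2.6 p.21] -/
theorem mem_thetaSet_two_of_le_of_one_le_deltaInv [IsTopologicalGroup G] {H' H₀ : Subgroup G}
    (hH' : IsOpen (H' : Set G)) (hle : H' ≤ H₀) (l : ℕ) [hl : Fact l.Prime]
    (h : 1 ≤ deltaInv ↥H' 2 l) : l ∈ thetaSet ↥H₀ 2 := by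
  refine ⟨hl.out, ?_⟩
  obtain ⟨e⟩ := nonempty_continuousMulEquiv_subgroupOf hle
  have h1 : ((3 - 2 : ℕ) : ℕ∞) = 1 := by norm_num
  rw [h1]
  unfold epsilonInv
  refine le_iSup₂_of_le (H'.subgroupOf H₀) (isOpen_subgroupOf H₀ hH') ?_
  rw [deltaInv_eq_of_continuousMulEquiv e 2 l]
  exact h

end Subgroups

namespace FundamentalExtension

variable {E : FundamentalExtension.{0}}

/-- **The Lemma 2.7 (iii) hook** (the input of `AbsTopIThm26PrimesOfRankExcessHook.lean`) **from
`Lem27iiiStep`**: an open `J ⊆ Π` with a positive (ii)-rank excess at some `l₀ ∈ Σ` has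
`{l ∈ Σ prime} ⊆ θ²(J)` — each prime `l ∈ Σ` gets an open `H′ ⊆ J` with `δ²_l(H′) ≥ 1`, so
`ε²_l(J) ≥ 1` (p. 23 l. 44–47). [cite: MochizukiAbsTopI2012, Thm 2.6 (iii) proof p.23] -/
theorem subset_thetaSet_two_of_rankExcess {S : Set ℕ} (h27 : E.Lem27iiiStep S)
    (J : Subgroup E.arith) (hJ : IsOpen (J : Set E.arith))
    (hex : ∃ (l₀ : ℕ) (_ : Fact l₀.Prime), l₀ ∈ S ∧
      freeProlRank ↥(J.map E.aug.toMonoidHom) l₀ < freeProlRank ↥J l₀) :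
    {l ∈ S | l.Prime} ⊆ thetaSet ↥J 2 := by
  obtain ⟨l₀, hl₀, hl₀S, hlt⟩ := hex
  rintro l ⟨hlS, hlp⟩
  haveI : Fact l.Prime := ⟨hlp⟩
  obtain ⟨H', hH'o, hH'le, hδ⟩ := h27 J hJ l₀ hl₀S hlt l hlS
  exact mem_thetaSet_two_of_le_of_one_le_deltaInv hH'o hH'le l hδ

/-- **[AbsTopI] Thm 2.6 (iii), second clause, inclusion form, for every open `H₀ ⊆ Π`, modulo
Lemma 2.7 (iii)**: for MLF base data, `Δ` pro-`Σ` and `Lem27iiiStep`, if `|θ¹(H₀)| ≥ 2` then every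
prime of `Σ` lies in `θ²(H₀)` (p. 23 l. 41–47; the reduction to a rank excess is abc-iut-w6-d034's
`MLFBase.subset_thetaSet_two_of_hook`). [cite: MochizukiAbsTopI2012, Thm 2.6 (iii) p.22] -/
theorem subset_thetaSet_two_of_lem27iiiStep (B : E.MLFBase) {S : Set ℕ}
    (hpro : IsProSet E.geom S) (h27 : E.Lem27iiiStep S) {H₀ : Subgroup E.arith}
    (hH₀ : IsOpen (H₀ : Set E.arith)) (hθ : 2 ≤ (thetaSet ↥H₀ 1).encard) :
    {l ∈ S | l.Prime} ⊆ thetaSet ↥H₀ 2 :=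
  MLFBase.subset_thetaSet_two_of_hook B hpro (subset_thetaSet_two_of_rankExcess h27) H₀ hH₀ hθ

/-- **[AbsTopI] Thm 2.6 (iii) AS TYPED, PROVED MODULO exactly Lemma 2.7 (iii)**: for an extension
with MLF base data, `Π` topologically finitely generated (Thm 2.6 (ii)), `Δ` pro-`Σ`, and the
Tate-module input `Lem27iiiStep`: `E.Thm26iii S` (first clause `thetaSet_two_subset_of_isProSet`;
second clause through abc-iut-w6-d034's `MLFBase.thm26iii_of_hook`).
[cite: MochizukiAbsTopI2012, Thm 2.6 (iii) p.22] -/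
theorem thm26iii_of_lem27iiiStep (B : E.MLFBase) {S : Set ℕ}
    (htfg : IsTopologicallyFinitelyGenerated E.arith) (hpro : IsProSet E.geom S)
    (h27 : E.Lem27iiiStep S) : E.Thm26iii S :=
  MLFBase.thm26iii_of_hook B htfg hpro (subset_thetaSet_two_of_rankExcess h27)

/-- **The successor row `Thm26iii′` holds for EVERY extension and every `Σ`** (closed kernel form of
[AbsTopI] Thm 2.6 (iii): MLF base data, `Π` tfg, `Δ` pro-`Σ`, Lemma 2.7 step ⟹ `Thm26iii`).
[cite: MochizukiAbsTopI2012, Thm 2.6 (iii) p.22] -/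
theorem thm26iii'_holds (E : FundamentalExtension.{0}) (S : Set ℕ) : E.Thm26iii' S :=
  fun ⟨B⟩ htfg hpro h27 => thm26iii_of_lem27iiiStep B htfg hpro h27

/-- **Thm 2.6 (iii) for every open `H ⊆ Π`, PROVED MODULO Lemma 2.7 (iii)** — both clauses, in the
shape of the input `hiii` of `MLFBase.thm26vFull_of_rank_of_thm26iii_open`: for MLF base data, `Π` tfg,
`Δ` pro-`Σ`, `Lem27iiiStep`. [cite: MochizukiAbsTopI2012, Thm 2.6 (iii) p.22] -/
theorem thm26iii_open_of_lem27iiiStep (B : E.MLFBase) {S : Set ℕ}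
    (htfg : IsTopologicallyFinitelyGenerated E.arith) (hpro : IsProSet E.geom S)
    (h27 : E.Lem27iiiStep S) :
    ∀ (H : Subgroup E.arith), IsOpen (H : Set E.arith) →
      thetaSet ↥H 2 ⊆ {l ∈ S | l.Prime} ∧
        (2 ≤ (thetaSet ↥H 1).encard → thetaSet ↥H 2 = {l ∈ S | l.Prime}) := by
  intro H hH
  have h1 := E.thetaSet_two_subset_of_isProSet_of_isOpen B htfg hpro hH
  exact ⟨h1, fun hθ => Set.Subset.antisymm h1 (subset_thetaSet_two_of_lem27iiiStep B hpro h27 hH hθ)⟩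

/-- **[AbsTopI] Thm 2.6 (v), general form, PROVED MODULO ⟨Prop 2.2, `Δ` pro-`Σ`, `Π` tfg, the
(ii)-rank identity per open `Π′`, Lemma 2.7 (iii)⟩** — abc-iut-w6-d034's
`MLFBase.thm26vFull_of_rank_of_thm26iii_open` with its input `hiii` discharged.
[cite: MochizukiAbsTopI2012, Thm 2.6 (v) p.22] -/
theorem MLFBase.thm26vFull_of_rank_of_lem27iiiStep (B : E.MLFBase) (S : Set ℕ)
    (hS : S ⊆ {q | q.Prime}) (hΔ : E.GeomTFG) (htfg : IsTopologicallyFinitelyGenerated E.arith)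
    (hΔS : IsProSet E.geom S)
    (hQ : ∀ (P : Subgroup E.arith), IsOpen (P : Set E.arith) → ∃ m : ℕ, ∀ (l : ℕ) [Fact l.Prime],
      l ∈ S → freeProlRank P l = freeProlRank (P.map E.aug.toMonoidHom) l + m)
    (h27 : E.Lem27iiiStep S) : E.Thm26vFull B :=
  MLFBase.thm26vFull_of_rank_of_thm26iii_open B S hS hΔ hΔS hQ
    (thm26iii_open_of_lem27iiiStep B htfg hΔS h27)

/-- **[AbsTopI] Thm 2.6 (v), general form, every `Σ ⊆ Primes`, PROVED MODULO ⟨Prop 2.2, `Π` tfg,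
`Δ` pro-`Σ`, the (ii)-rank identity (only when every prime lies in `Σ`), Lemma 2.7 (iii)⟩** —
abc-iut-w6-d034's `MLFBase.thm26vFull_of_hook` with the hook supplied by the fact.
[cite: MochizukiAbsTopI2012, Thm 2.6 (v) p.22] -/
theorem MLFBase.thm26vFull_of_lem27iiiStep (B : E.MLFBase) (S : Set ℕ) (hS : S ⊆ {q | q.Prime})
    (hΔ : E.GeomTFG) (htfg : IsTopologicallyFinitelyGenerated E.arith) (hΔS : IsProSet E.geom S)
    (hQ : (∀ q : ℕ, q.Prime → q ∈ S) → ∀ (P : Subgroup E.arith), IsOpen (P : Set E.arith) →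
      ∃ m : ℕ, ∀ (l : ℕ) [Fact l.Prime],
        freeProlRank P l = freeProlRank (P.map E.aug.toMonoidHom) l + m)
    (h27 : E.Lem27iiiStep S) : E.Thm26vFull B :=
  MLFBase.thm26vFull_of_hook B S hS hΔ htfg hΔS hQ (subset_thetaSet_two_of_rankExcess h27)

/-- **The `Σ = Primes` regime of [IUTchI–III], PROVED MODULO exactly Lemma 2.7 (iii)**: for an
extension with MLF base data that splits over an open subgroup of `G`, with `Δ` tfg, (∗) ([AbsAnab]
Lemma 1.1.4 (ii) hypotheses) and `Π` tfg: `Lem27iiiStep Primes ⟹ E.Thm26vFull B`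
(abc-iut-w6-d034's `MLFBase.thm26vFull_of_starCondition_of_hook`).
[cite: MochizukiAbsTopI2012, Thm 2.6 (v) p.22] -/
theorem MLFBase.thm26vFull_of_starCondition_of_lem27iiiStep (B : E.MLFBase)
    (hs : E.SplitsOverOpenSubgroup) (hΔ : E.GeomTFG) (hstar : E.StarCondition)
    (htfg : IsTopologicallyFinitelyGenerated E.arith) (h27 : E.Lem27iiiStep {q | q.Prime}) :
    E.Thm26vFull B := by
  refine MLFBase.thm26vFull_of_starCondition_of_hook B hs hΔ hstar htfg fun J hJ hex => ?_
  obtain ⟨l₀, hl₀, hlt⟩ := hex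
  intro l hl
  exact subset_thetaSet_two_of_rankExcess h27 J hJ ⟨l₀, hl₀, hl₀.out, hlt⟩ ⟨hl, hl⟩

end FundamentalExtension

end Literature.AnabelianGeometry.AbsoluteAnabelian

end
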